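import Literature.MathematicalPhysics.QuantumFieldTheory.Balaban1983to89.B3Ineq326Curly
import Literature.MathematicalPhysics.QuantumFieldTheory.Balaban1983to89.B3Ineq314Local

/-!
# `Balaban1983to89.B3Ineq326CurlyLocal` — T. Bałaban, *(Higgs)₂,₃ quantum fields in a finite volume. III. Renormalization*, Commun. Math.
Phys. **88** (1983) 411–445 [Balaban1983Higgs3], p. 440 [PDF 30]: the last curly bracket of **(3.26)** *"can be analyzed as in (3.13),
(3.14)"* — the **(3.14)** half of that sentence (the localized bound of the leg through (2.11) and the third exponential factor), PROVED in
POINTWISE form; p20 g3's `B3Ineq326Curly.abs_curly2_le` was the (3.13) half (global Hölder constant of the leg)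

statement-level skeleton of published theorems with citation tags; proofs where landed; nothing here is a claim about the Yang–Mills mass gap

PDF held: `paper:balaban1983-higgs-2-3-quantum-fields-finite-volume` (journal page = PDF page + 410); p. 440 [PDF 30] and p. 436 [PDF 26] read
on the renders `run/shared/lean/pub/pub-balaban/b2b-balaban-ref1/pages/1983-cmp88-higgs23-III/1983-cmp88-higgs23-III-p030-x2.png` / `…-p026-x4.png`.

CITATION HEADER (lean-in-tree rule).  Part of the lit-balaban TYPED SKELETON (HOME `run/shared/lean/pub/lit-balaban/`), PHASE 2, seat p20
generation 4; companion of `B3Ineq326Curly` (p20 g3, p250565: the kernel bound `abs_kerC_le` and the (3.13)-type estimate `abs_curly2_le`)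
and of `B3Ineq314Local` (p20 g4: the localized remainder bound `norm_remFwd_le_of_leg`, the exponential bookkeeping
`exp_mul_weight_le_local`).  WHAT IS REPRODUCED: row **B3.Eq3.25-3.32** of `HOME/lit-balaban-r15/ROWS-B3.md` (fold owner r15), the p. 440
sentence on the last curly bracket of (3.26) (r15's `B3Sect3VectorSelfEnergy.curly2`).

THE PRINTED TEXT (verbatim, p. 440).  *"where A, A′ are external vector field legs. The expressions in the last curly bracket above are the
generalized expressions of the same form as in (3.11), they have positive degree −d+3+α and can be analyzed as in (3.13), (3.14), and
Proposition 2.2 can be applied."*  (3.14) p. 436: *"If φ′ is a leg of a propagator with an index j″, whose second leg is localized in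
Δ(v″), then the last supremum in (3.13) can be estimated by O(1)(L^{j″}η)^{−d+1−α} sup_{x∈Δ(v),x′∈Δ(v′)} exp[−δ₀(L^{j″}η)^{−1}dist(Γ_{x,x′},
Δ(v″))], and the exponential factor together with another exponential factor in (3.13) give us the estimate (3.14)"*.

WHAT IS PROVED, and how.  **`abs_curly2_le_local`**: under the (2.10)-type bounds on the four kernels of the bracket at the scales
`s = L^jη`, `s′ = L^{j′}η` (as in `abs_curly2_le`: degrees −d+1, −d+1 resp. −d+2, −d, rate δ), `|g| ≤ 1`, and — in place of the global
Hölder hypothesis on the leg functions `g′A′_{μ′}` — the LOCALIZED (2.11)-type two-point bound around the position `x″` of the second leg of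
their propagator (index `j″`, `s″ = L^{j″}η ≥ max(s,s′)`, `η ≤ s″`, `C₅` standing for `O(1)(L^{j″}η)^{−d+1−α}`), the last curly bracket `curly2`
of (3.26) with the (3.10) remainder `remFwd` of the legs satisfies
`|curly2| ≤ 8d|τ|C₅e^{δ/2}(2/δ + 8/δ²)(C₁C₂s^{1−d}s′^{1−d} + C₃C₄s^{2−d}s′^{−d})·(m·m^α)·Σ_{x,x′}η^{2d}(Σ_μ|A_μ(x)|)e^{−½δ|x−x′|/s}e^{−½δ|x−x′|/s′}
e^{−½δ|x−x″|/s″}`, `m = min(s,s′) = L^{j₁}η` — the factors of (3.14) for the vector self-energy bracket (kernel degree −2d+2, the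
(L^{j₁}η)^{1+α} of the remainder, the three half-rate exponentials).  Mechanism = `B3Ineq314Local.norm_remFwd_le_of_leg` (contour
localization, triangle inequality of the `ℓ¹` torus distance) + `exp_mul_weight_le_local` (half of the larger-index exponential absorbs the
growth `e^{½δ|x−x′|/s″}`).  The kernel bounds are HYPOTHESES (rows B3.Eq2.10–2.12); the cube localization is not performed.  D-0026:
theorems only, no `def`, no named fact; standard axioms.  Unit `lit-balaban-p20` (literature-prover-lit-balaban-p20-g4-0), 2026-08-21.
-/

open scoped BigOperators

namespace Literature.MathematicalPhysics.QuantumFieldTheory.Balaban1983to89.B3Ineq326CurlyLocal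

open LatticeFieldCalculus B3Sect3ScalarSelfEnergy B3Sect3VectorSelfEnergy B3Taylor310Remainder B3Ineq313Pointwise B3Ineq326Curly
  B3Ineq314Local

noncomputable section

variable {P : Params} {j : ℕ}

/-- **p. 440 [PDF 30], the last curly bracket of (3.26) "analyzed as in (3.13), (3.14)" — the (3.14) step, POINTWISE, PROVED**: with the
LOCALIZED (2.11)-type two-point bound on the derivative of each leg function `g′A′_{μ′}` around the position `x″` of the second leg of its
propagator (`hleg`; `C₅` for `O(1)(L^{j″}η)^{−d+1−α}`, `s″ = L^{j″}η ≥ max(s,s′)`, `η ≤ s″`) in place of the global Hölder constant of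
`B3Ineq326Curly.abs_curly2_le`, and the same (2.10)-type bounds on the four kernels, `|curly2| ≤ 8d|τ|C₅e^{δ/2}(2/δ + 8/δ²)(C₁C₂s^{1−d}s′^{1−d} +
C₃C₄s^{2−d}s′^{−d})(m·m^α)Σ_{x,x′}η^{2d}(Σ_μ|A_μ(x)|)e^{−½δ|x−x′|/s}e^{−½δ|x−x′|/s′}e^{−½δ|x−x″|/s″}`, `m = min(s,s′)`.
[cite: Balaban1983Higgs3, (3.26) p.440] -/
theorem abs_curly2_le_local (η : ℝ) (hη : 0 < η) {α τ C₁ C₂ C₃ C₄ C₅ δ s s' s'' : ℝ} (hα0 : 0 ≤ α) (hα1 : α ≤ 1) (hC₅ : 0 ≤ C₅)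
    (hδ : 0 < δ) (hs : 0 < s) (hs' : 0 < s') (hss : max s s' ≤ s'') (hηs'' : η ≤ s'')
    (Gj Gj' : Kernel P j) (g : SiteField P j ℝ) (hg : ∀ x, |g x| ≤ 1)
    (A : VecField P j ℝ) (g' : SiteField P j ℝ) (A' : VecField P j ℝ)
    (hA : ∀ (μ' : Fin P.d) (x x' : Site P j),
      |dAdjKernel η⁻¹ μ' Gj x x'| ≤ C₁ * s ^ (1 - (P.d : ℝ)) * Real.exp (-(δ * s⁻¹ * (η * Site.tdist x x'))))
    (hA' : ∀ (μ : Fin P.d) (x x' : Site P j),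
      |dAdjKernel η⁻¹ μ Gj' x' x| ≤ C₂ * s' ^ (1 - (P.d : ℝ)) * Real.exp (-(δ * s'⁻¹ * (η * Site.tdist x x'))))
    (hB : ∀ x x' : Site P j, |Gj x x'| ≤ C₃ * s ^ (2 - (P.d : ℝ)) * Real.exp (-(δ * s⁻¹ * (η * Site.tdist x x'))))
    (hB' : ∀ (μ μ' : Fin P.d) (x x' : Site P j),
      |d2Kernel η⁻¹ μ' μ Gj' x' x| ≤ C₄ * s' ^ (-(P.d : ℝ)) * Real.exp (-(δ * s'⁻¹ * (η * Site.tdist x x'))))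
    (x'' : Site P j)
    (hleg : ∀ (μ' ν : Fin P.d) (z z' : Site P j), ‖pdiff η⁻¹ ν (legFn g' A' μ') z - pdiff η⁻¹ ν (legFn g' A' μ') z'‖ ≤
      C₅ * (η * Site.tdist z z') ^ α * Real.exp (-(δ * s''⁻¹ * (η * ((min (Site.tdist z x'') (Site.tdist z' x'') : ℕ) : ℝ))))) :
    |curly2 η τ Gj Gj' g A (fun μ' x x' => remFwd η⁻¹ (legFn g' A' μ') x x')| ≤
      8 * P.d * |τ| * C₅ * Real.exp (δ / 2) * (2 / δ + 8 / δ ^ 2) *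
        (C₁ * C₂ * (s ^ (1 - (P.d : ℝ)) * s' ^ (1 - (P.d : ℝ))) + C₃ * C₄ * (s ^ (2 - (P.d : ℝ)) * s' ^ (-(P.d : ℝ)))) *
        (min s s' * (min s s') ^ α) *
        ∑ x : Site P j, ∑ x' : Site P j, η ^ (2 * P.d) *
          ((∑ μ : Fin P.d, |A ⟨x, μ⟩|) * (Real.exp (-(δ / 2 * s⁻¹ * (η * Site.tdist x x'))) *
            Real.exp (-(δ / 2 * s'⁻¹ * (η * Site.tdist x x')))) * Real.exp (-(δ / 2 * s''⁻¹ * (η * Site.tdist x x'')))) := by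
  have hs'' : 0 < s'' := lt_of_lt_of_le (lt_max_of_lt_left hs) hss
  -- the kernel constant (nonnegative, as forced by the hypotheses)
  set Kc : ℝ := |τ| * (C₁ * C₂ * (s ^ (1 - (P.d : ℝ)) * s' ^ (1 - (P.d : ℝ))) +
    C₃ * C₄ * (s ^ (2 - (P.d : ℝ)) * s' ^ (-(P.d : ℝ)))) with hKc
  have hKc0 : 0 ≤ Kc := by
    have h := (abs_nonneg _).trans (abs_kerC_le (τ := τ) hA hA' hB hB' ⟨0, P.hd⟩ ⟨0, P.hd⟩ default default)
    have hpos : 0 < Real.exp (-(δ * s⁻¹ * (η * Site.tdist (default : Site P j) default))) *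
        Real.exp (-(δ * s'⁻¹ * (η * Site.tdist (default : Site P j) default))) := mul_pos (Real.exp_pos _) (Real.exp_pos _)
    exact nonneg_of_mul_nonneg_left h hpos
  -- the full constant
  set K : ℝ := 8 * P.d * |τ| * C₅ * Real.exp (δ / 2) * (2 / δ + 8 / δ ^ 2) *
    (C₁ * C₂ * (s ^ (1 - (P.d : ℝ)) * s' ^ (1 - (P.d : ℝ))) + C₃ * C₄ * (s ^ (2 - (P.d : ℝ)) * s' ^ (-(P.d : ℝ)))) *
    (min s s' * (min s s') ^ α) with hK
  -- the bound per (x, x′, μ, μ′)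
  have hterm : ∀ (x x' : Site P j) (μ μ' : Fin P.d),
      |g x * A ⟨x, μ⟩ * kerC η τ Gj Gj' μ μ' x x' * remFwd η⁻¹ (legFn g' A' μ') x x'| ≤
        |A ⟨x, μ⟩| * (Kc * (8 * C₅ * Real.exp (δ / 2)) * ((2 / δ + 8 / δ ^ 2) * (min s s' * (min s s') ^ α) *
          (Real.exp (-(δ / 2 * s⁻¹ * (η * Site.tdist x x'))) * Real.exp (-(δ / 2 * s'⁻¹ * (η * Site.tdist x x'))))) *
          Real.exp (-(δ / 2 * s''⁻¹ * (η * Site.tdist x x'')))) := by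
    intro x x' μ μ'
    set u : ℝ := η * Site.tdist x x' with hu
    have hu0 : 0 ≤ u := mul_nonneg hη.le (Nat.cast_nonneg _)
    set E'' : ℝ := Real.exp (-(δ / 2 * s''⁻¹ * (η * Site.tdist x x''))) with hE''
    have hE0 : 0 ≤ E'' := (Real.exp_pos _).le
    -- the remainder through the localized (2.11)-type bound on the leg g′A′_{μ′}
    have hR : |remFwd η⁻¹ (legFn g' A' μ') x x'| ≤
        8 * C₅ * Real.exp (δ / 2) * (u * u ^ α) * Real.exp (δ / 2 * s''⁻¹ * u) * E'' := by
      have h := norm_remFwd_le_of_leg hη hα0 hα1 hC₅ hδ hs'' hηs'' x'' (hleg μ') x x'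
      rw [Real.norm_eq_abs] at h
      exact h
    have hk := abs_kerC_le (τ := τ) hA hA' hB hB' μ μ' x x'
    have hweight := exp_mul_weight_le_local hδ hs hs' hss hu0 hα0 hα1
    have hgx := hg x
    calc |g x * A ⟨x, μ⟩ * kerC η τ Gj Gj' μ μ' x x' * remFwd η⁻¹ (legFn g' A' μ') x x'|
        = |g x| * |A ⟨x, μ⟩| * |kerC η τ Gj Gj' μ μ' x x'| * |remFwd η⁻¹ (legFn g' A' μ') x x'| := by
          rw [abs_mul, abs_mul, abs_mul]
      _ ≤ 1 * |A ⟨x, μ⟩| * (Kc * (Real.exp (-(δ * s⁻¹ * u)) * Real.exp (-(δ * s'⁻¹ * u)))) *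
          (8 * C₅ * Real.exp (δ / 2) * (u * u ^ α) * Real.exp (δ / 2 * s''⁻¹ * u) * E'') := by
          gcongr
      _ = |A ⟨x, μ⟩| * (Kc * (8 * C₅ * Real.exp (δ / 2))) *
          (Real.exp (-(δ * s⁻¹ * u)) * Real.exp (-(δ * s'⁻¹ * u)) * Real.exp (δ / 2 * s''⁻¹ * u) * (u * u ^ α)) * E'' := by ring
      _ ≤ |A ⟨x, μ⟩| * (Kc * (8 * C₅ * Real.exp (δ / 2))) * ((2 / δ + 8 / δ ^ 2) * (min s s' * (min s s') ^ α) *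
          (Real.exp (-(δ / 2 * s⁻¹ * u)) * Real.exp (-(δ / 2 * s'⁻¹ * u)))) * E'' :=
          mul_le_mul_of_nonneg_right (mul_le_mul_of_nonneg_left hweight (by positivity)) hE0
      _ = _ := by ring
  -- summation over μ, μ′ at fixed (x, x′)
  have hinner : ∀ x x' : Site P j,
      |η ^ (2 * P.d) * ∑ μ : Fin P.d, ∑ μ' : Fin P.d,
          g x * A ⟨x, μ⟩ * kerC η τ Gj Gj' μ μ' x x' * remFwd η⁻¹ (legFn g' A' μ') x x'| ≤
        K * (η ^ (2 * P.d) * ((∑ μ : Fin P.d, |A ⟨x, μ⟩|) *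
          (Real.exp (-(δ / 2 * s⁻¹ * (η * Site.tdist x x'))) * Real.exp (-(δ / 2 * s'⁻¹ * (η * Site.tdist x x')))) *
          Real.exp (-(δ / 2 * s''⁻¹ * (η * Site.tdist x x''))))) := by
    intro x x'
    set E : ℝ := Real.exp (-(δ / 2 * s⁻¹ * (η * Site.tdist x x'))) * Real.exp (-(δ / 2 * s'⁻¹ * (η * Site.tdist x x')))
      with hE
    set E'' : ℝ := Real.exp (-(δ / 2 * s''⁻¹ * (η * Site.tdist x x''))) with hE''
    rw [abs_mul, abs_of_nonneg (by positivity : (0 : ℝ) ≤ η ^ (2 * P.d))]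
    have hsum : |∑ μ : Fin P.d, ∑ μ' : Fin P.d,
          g x * A ⟨x, μ⟩ * kerC η τ Gj Gj' μ μ' x x' * remFwd η⁻¹ (legFn g' A' μ') x x'| ≤
        ∑ μ : Fin P.d, ∑ _μ' : Fin P.d, |A ⟨x, μ⟩| *
          (Kc * (8 * C₅ * Real.exp (δ / 2)) * ((2 / δ + 8 / δ ^ 2) * (min s s' * (min s s') ^ α) * E) * E'') := by
      refine (Finset.abs_sum_le_sum_abs _ _).trans (Finset.sum_le_sum fun μ _ => ?_)
      exact (Finset.abs_sum_le_sum_abs _ _).trans (Finset.sum_le_sum fun μ' _ => hterm x x' μ μ')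
    have hconst : ∑ μ : Fin P.d, ∑ _μ' : Fin P.d, |A ⟨x, μ⟩| *
          (Kc * (8 * C₅ * Real.exp (δ / 2)) * ((2 / δ + 8 / δ ^ 2) * (min s s' * (min s s') ^ α) * E) * E'')
        = P.d * (Kc * (8 * C₅ * Real.exp (δ / 2)) * ((2 / δ + 8 / δ ^ 2) * (min s s' * (min s s') ^ α))) *
          ((∑ μ : Fin P.d, |A ⟨x, μ⟩|) * E * E'') := by
      simp only [Finset.sum_const, Finset.card_univ, Fintype.card_fin, nsmul_eq_mul, Finset.sum_mul, Finset.mul_sum]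
      exact Finset.sum_congr rfl fun μ _ => by ring
    calc η ^ (2 * P.d) * |∑ μ : Fin P.d, ∑ μ' : Fin P.d,
            g x * A ⟨x, μ⟩ * kerC η τ Gj Gj' μ μ' x x' * remFwd η⁻¹ (legFn g' A' μ') x x'|
        ≤ η ^ (2 * P.d) * (P.d * (Kc * (8 * C₅ * Real.exp (δ / 2)) * ((2 / δ + 8 / δ ^ 2) * (min s s' * (min s s') ^ α))) *
            ((∑ μ : Fin P.d, |A ⟨x, μ⟩|) * E * E'')) := by
          rw [← hconst]
          exact mul_le_mul_of_nonneg_left hsum (by positivity)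
      _ = K * (η ^ (2 * P.d) * ((∑ μ : Fin P.d, |A ⟨x, μ⟩|) * E * E'')) := by rw [hK, hKc]; ring
  -- summation over x, x′
  unfold curly2 pairSum
  calc |∑ x : Site P j, ∑ x' : Site P j, η ^ (2 * P.d) * ∑ μ : Fin P.d, ∑ μ' : Fin P.d,
          g x * A ⟨x, μ⟩ * kerC η τ Gj Gj' μ μ' x x' * remFwd η⁻¹ (legFn g' A' μ') x x'|
      ≤ ∑ x : Site P j, |∑ x' : Site P j, η ^ (2 * P.d) * ∑ μ : Fin P.d, ∑ μ' : Fin P.d,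
          g x * A ⟨x, μ⟩ * kerC η τ Gj Gj' μ μ' x x' * remFwd η⁻¹ (legFn g' A' μ') x x'| := Finset.abs_sum_le_sum_abs _ _
    _ ≤ ∑ x : Site P j, ∑ x' : Site P j, |η ^ (2 * P.d) * ∑ μ : Fin P.d, ∑ μ' : Fin P.d,
          g x * A ⟨x, μ⟩ * kerC η τ Gj Gj' μ μ' x x' * remFwd η⁻¹ (legFn g' A' μ') x x'| :=
        Finset.sum_le_sum fun x _ => Finset.abs_sum_le_sum_abs _ _
    _ ≤ ∑ x : Site P j, ∑ x' : Site P j, K * (η ^ (2 * P.d) * ((∑ μ : Fin P.d, |A ⟨x, μ⟩|) *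
          (Real.exp (-(δ / 2 * s⁻¹ * (η * Site.tdist x x'))) * Real.exp (-(δ / 2 * s'⁻¹ * (η * Site.tdist x x')))) *
          Real.exp (-(δ / 2 * s''⁻¹ * (η * Site.tdist x x''))))) :=
        Finset.sum_le_sum fun x _ => Finset.sum_le_sum fun x' _ => hinner x x'
    _ = K * ∑ x : Site P j, ∑ x' : Site P j, η ^ (2 * P.d) * ((∑ μ : Fin P.d, |A ⟨x, μ⟩|) *
          (Real.exp (-(δ / 2 * s⁻¹ * (η * Site.tdist x x'))) * Real.exp (-(δ / 2 * s'⁻¹ * (η * Site.tdist x x')))) *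
          Real.exp (-(δ / 2 * s''⁻¹ * (η * Site.tdist x x'')))) := by
        rw [Finset.mul_sum]
        exact Finset.sum_congr rfl fun x _ => by rw [Finset.mul_sum]

end

end Literature.MathematicalPhysics.QuantumFieldTheory.Balaban1983to89.B3Ineq326CurlyLocal
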